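import Summits.Schanuel.Schanuel.Theorems.ZilberEacMovingLine
import HarnessLib

/-!
# The moving-target line family in the FAST regime `a (1 + deg F) > 1`

Zilber's Exponential-Algebraic Closedness, case ladder (host summit Schanuel, cell `pub-schanuel`,
seat 2, gen 8).  `ZilberEacMovingLine` proved the Zariski density of the exponential points of
`W(a, b; A, F) = {x₁ = a x₀ + b, y₀ = A(x₀) + y₁ F(y₁)}` for real irrational slopes in the SLOW
regime `a (1 + deg F) < 1` (there `e^{z} ≈ A(z)` near the lattice centres `2πi m + log A(2πi m)`).
Here the complementary FAST regime `a (1 + deg F) > 1` (`F ≠ 0`, `deg A ≥ 1`):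

**Idea.**  Put `e = 1 + deg F`, `c = lc(F)`, `w = a z + b`, `W = e w`.  Then
`e^{w} F(e^{w}) = c e^{W} + u F̃(u)` (`u = e^{w} = e^{W/e}`, `F̃ = F` minus its leading term), so the
equation `e^{z} = A(z) + e^{w} F(e^{w})` reads
`e^{W} = Â(W) + P(W)`, `Â(W) = -A(W/(ea) - b/a)/c`, `P(W) = (e^{W/(ea) - b/a} - u F̃(u))/c`,
and near the lattice centres `2πi k + log Â(2πi k)` (`Re W = d log k + O(1)`, `d = deg A`) the
perturbation is RELATIVELY small: `|e^{W/(ea)}| ≍ k^{d/(ea)} = o(k^{d})` exactly when `e a > 1`, and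
`|u F̃(u)| = O(k^{d (e-1)/e}) = o(k^{d})`.  The relative moving-polydisc theorem
(`exists_exp_eq_poly_add_near_latticeCentre_local`) gives solutions, along which
`log |y₀| = Re z = (d/(ea)) log k + O(1)` and `log |y₁| = Re w = (d/e) log k + O(1)` — growth exponents
in ratio `1 : a`, so THEOREM I (`unprojectedDense_of_logGrowth_irrational`) gives density.

* `eventually_exists_solution_realLine_fast` — existence in the fast regime (NEW solutions of
  `e^{z} = A(z) + e^{az+b} F(e^{az+b})`, e.g. `e^{z} = z + e^{2√2 z} + e^{√2 z}`);
* `unprojectedDense_movingLine_real_fast` — density in the fast regime;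
* `unprojectedDense_movingLine_real_all` — EVERY `a ∈ ℝ ∖ ℚ`, every `b`, `deg A ≥ 1`, EVERY `F`;
* `unprojectedDense_movingLine` — EVERY `a ∈ ℂ ∖ ℚ` (with `…_of_im_ne_zero`): the exponential points
  of `W(a, b; A, F)` are Zariski dense.  (Cell membership and the typed question:
  `ZilberEacMovingLineAll`.)

HONEST FRAMING: explicit families of instances of an OPEN question (Mantova–Masser 2024 §1); the
general free question, non-line bases and `EC(3,2)` remain OPEN; NOT Schanuel's conjecture; EAC ⇏ SC.
-/

noncomputable section

open Complex MvPolynomial Filter Topology Metric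
open Literature.NumberTheory.Transcendental Literature.ModelTheory.Zilber

set_option linter.dupNamespace false

namespace Summit.Schanuel.Schanuel.Theorems

/-! ## Part 1. Two small analytic lemmas -/

section Lemmas

/-- **Lattice-centre control with a radius.**  For `A ≠ 0`, `q ≠ 0` and a radius `ρ` there are `C` and
`t₀ ≥ 1` such that for every `m ≥ t₀` and every `x` within `ρ` of the lattice centre
`2πi q m + log A(2πi q m)`: `|Re x - deg A · log m| ≤ C` and `|Im x - 2π q m| ≤ C`. [folklore] -/
theorem latticeCentre_control_radius {A : Polynomial ℂ} (hA : A ≠ 0) {q : ℤ} (hq : q ≠ 0)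
    (ρ : ℝ) :
    ∃ C t₀ : ℝ, 1 ≤ t₀ ∧ ∀ m : ℕ, t₀ ≤ (m : ℝ) → ∀ x : ℂ,
      ‖x - ((m : ℂ) * (2 * Real.pi * I * (q : ℂ)) +
        log (A.eval ((m : ℂ) * (2 * Real.pi * I * (q : ℂ)))))‖ ≤ ρ →
      |x.re - A.natDegree * Real.log m| ≤ C ∧ |x.im - 2 * Real.pi * q * m| ≤ C := by
  set v : Fin 1 → ℂ := fun _ => 2 * Real.pi * I * (q : ℂ) with hv
  have hv0 : v 0 ≠ 0 := by
    simp only [hv]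
    have hpi : (Real.pi : ℂ) ≠ 0 := Complex.ofReal_ne_zero.2 Real.pi_ne_zero
    have hq' : (q : ℂ) ≠ 0 := Int.cast_ne_zero.2 hq
    exact mul_ne_zero (mul_ne_zero (mul_ne_zero two_ne_zero hpi) Complex.I_ne_zero) hq'
  have hlead := eval_leadingForm_toMvPolynomial_fin_one_ne_zero hA hv0
  obtain ⟨ρ', -, t₀, ht₀, hc⟩ := latticeValue_control (A.toMvPolynomial 0) v hlead one_pos
  set c₀ : ℝ := ‖eval v (homogeneousComponent (A.toMvPolynomial (0 : Fin 1)).totalDegree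
    (A.toMvPolynomial (0 : Fin 1)))‖ with hc₀
  have hc₀pos : 0 < c₀ := norm_pos_iff.2 hlead
  refine ⟨|Real.log (c₀ / 2)| + |Real.log (2 * c₀)| + Real.pi + ρ, t₀, ht₀, fun m hm x hx => ?_⟩
  obtain ⟨-, hlow, hupp, -⟩ := hc m hm
  have hev : eval (fun i => (m : ℂ) * v i) (A.toMvPolynomial (0 : Fin 1)) =
      A.eval ((m : ℂ) * (2 * Real.pi * I * (q : ℂ))) := by
    rw [MvPolynomial.eval_toMvPolynomial]
  rw [hev, totalDegree_toMvPolynomial_fin_one] at hlow hupp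
  have hm1 : (1 : ℝ) ≤ m := ht₀.trans hm
  obtain ⟨h1, h2, -⟩ := log_latticeValue_bounds (by positivity : 0 < c₀ / 2) hm1 hlow hupp
  set α : ℂ := A.eval ((m : ℂ) * (2 * Real.pi * I * (q : ℂ))) with hα
  set ξ : ℂ := x - ((m : ℂ) * (2 * Real.pi * I * (q : ℂ)) + log α) with hξ
  have hxeq : x = ((m : ℂ) * (2 * Real.pi * I * (q : ℂ)) + log α) + ξ := by rw [hξ]; ring
  have hξre : |ξ.re| ≤ ρ := (Complex.abs_re_le_norm ξ).trans hx
  have hξim : |ξ.im| ≤ ρ := (Complex.abs_im_le_norm ξ).trans hx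
  have hre : x.re = Real.log ‖α‖ + ξ.re := by
    rw [hxeq, Complex.add_re, Complex.add_re, re_natCast_mul_twoPiI_intCast, Complex.log_re, zero_add]
  have him : x.im = 2 * Real.pi * q * m + Complex.arg α + ξ.im := by
    rw [hxeq, Complex.add_im, Complex.add_im, im_natCast_mul_twoPiI_intCast, Complex.log_im]
  have harg : |Complex.arg α| ≤ Real.pi := Complex.abs_arg_le_pi α
  rw [abs_le] at hξre hξim harg
  constructor
  · rw [hre, abs_le]
    constructor
    · have : -|Real.log (c₀ / 2)| ≤ Real.log (c₀ / 2) := neg_abs_le _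
      have : 0 ≤ |Real.log (2 * c₀)| := abs_nonneg _
      nlinarith [Real.pi_pos]
    · have : Real.log (2 * c₀) ≤ |Real.log (2 * c₀)| := le_abs_self _
      have : 0 ≤ |Real.log (c₀ / 2)| := abs_nonneg _
      nlinarith [Real.pi_pos]
  · rw [him, abs_le]
    have : 0 ≤ |Real.log (c₀ / 2)| := abs_nonneg _
    have : 0 ≤ |Real.log (2 * c₀)| := abs_nonneg _
    constructor <;> linarith

/-- `K m^{μ} ≤ θ m^{d}` for all large `m` when `μ < d` and `θ > 0`. [folklore] -/
theorem eventually_const_mul_rpow_le (K : ℝ) {μ d θ : ℝ} (hμ : μ < d) (hθ : 0 < θ) :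
    ∀ᶠ m : ℕ in atTop, K * (m : ℝ) ^ μ ≤ θ * (m : ℝ) ^ d := by
  have hgap : 0 < d - μ := by linarith
  have h1 : Tendsto (fun m : ℕ => (m : ℝ) ^ (d - μ)) atTop atTop :=
    (tendsto_rpow_atTop hgap).comp tendsto_natCast_atTop_atTop
  filter_upwards [h1.eventually_ge_atTop (K / θ), eventually_ge_atTop 1] with m hm hm_one
  have hm0 : (0 : ℝ) < m := by exact_mod_cast hm_one
  have h2 : K ≤ θ * (m : ℝ) ^ (d - μ) := by
    rw [div_le_iff₀ hθ] at hm
    linarith [hm]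
  calc K * (m : ℝ) ^ μ ≤ θ * (m : ℝ) ^ (d - μ) * (m : ℝ) ^ μ :=
        mul_le_mul_of_nonneg_right h2 (Real.rpow_nonneg hm0.le _)
    _ = θ * (m : ℝ) ^ d := by rw [mul_assoc, ← Real.rpow_add hm0, sub_add_cancel]

end Lemmas

/-! ## Part 2. Existence in the fast regime -/

section Fast

/-- The substituted additive polynomial `Â(W) = -A(W/(ea) - b/a)/c` of the fast regime
(`e = 1 + deg F`, `c = lc F`). [folklore] -/
def fastPoly (a : ℝ) (b : ℂ) (A F : Polynomial ℂ) : Polynomial ℂ :=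
  Polynomial.C (-(F.leadingCoeff)⁻¹) *
    A.comp (linePoly ((((F.natDegree + 1 : ℕ) : ℝ) * a)⁻¹ : ℝ) (-(b / a)))

/-- `deg Â = deg A` (`a ≠ 0`, `F ≠ 0`). [folklore] -/
theorem natDegree_fastPoly {a : ℝ} (ha : a ≠ 0) (b : ℂ) (A : Polynomial ℂ) {F : Polynomial ℂ}
    (hF : F ≠ 0) : (fastPoly a b A F).natDegree = A.natDegree := by
  have hc : -(F.leadingCoeff)⁻¹ ≠ 0 := neg_ne_zero.2 (inv_ne_zero (Polynomial.leadingCoeff_ne_zero.2 hF))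
  have hκ : ((((((F.natDegree + 1 : ℕ) : ℝ) * a)⁻¹ : ℝ)) : ℂ) ≠ 0 := by
    have : (((F.natDegree + 1 : ℕ) : ℝ) * a)⁻¹ ≠ 0 := inv_ne_zero (mul_ne_zero (by positivity) ha)
    exact_mod_cast this
  rw [fastPoly, Polynomial.natDegree_C_mul hc, Polynomial.natDegree_comp, linePoly,
    Polynomial.natDegree_linear hκ, mul_one]

/-- The leading-term splitting `u F(u) = lc(F) u^{deg F + 1} + u F̃(u)`, `F̃ = eraseLead F`.
[folklore] -/
theorem mul_eval_eq_leadingCoeff_mul_pow_add (F : Polynomial ℂ) (u : ℂ) :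
    u * F.eval u = F.leadingCoeff * u ^ (F.natDegree + 1) + u * F.eraseLead.eval u := by
  conv_lhs => rw [← Polynomial.eraseLead_add_monomial_natDegree_leadingCoeff F]
  rw [Polynomial.eval_add, Polynomial.eval_monomial]
  ring

/-- **Existence in the fast regime.**  Let `a ∈ ℝ`, `b ∈ ℂ`, `A ∈ ℂ[x]` of degree `d ≥ 1`,
`F ∈ ℂ[u] ∖ {0}` with `e = 1 + deg F` and `a e > 1`.  Then for all large `k` there is `W` within
`1/2` of the lattice centre `2πi k + log Â(2πi k)` of `Â = fastPoly a b A F` such that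
`z := W/(ea) - b/a` solves `e^{z} = A(z) + e^{a z + b} F(e^{a z + b})` (and `a z + b = W/e`).  Proof:
the relative moving-polydisc theorem for `e^{W} = Â(W) + (e^{z} - u F̃(u))/c`, `u = e^{W/e}`: on the
unit polydisc `|e^{z}| ≲ k^{d/(ea)}` and `|u F̃(u)| ≲ k^{d(e-1)/e}`, both `o(k^{d})`. (new)
[cite: MantovaMasser2023, §1 Further remarks] -/
theorem eventually_exists_solution_realLine_fast {a : ℝ} (b : ℂ) {A : Polynomial ℂ}
    (hA : 0 < A.natDegree) {F : Polynomial ℂ} (hF : F ≠ 0)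
    (hfast : 1 < a * (F.natDegree + 1)) :
    ∀ᶠ k : ℕ in atTop, ∃ W : ℂ,
      ‖W - ((k : ℂ) * (2 * Real.pi * I * ((1 : ℤ) : ℂ)) +
        log ((fastPoly a b A F).eval ((k : ℂ) * (2 * Real.pi * I * ((1 : ℤ) : ℂ)))))‖ ≤ 1 / 2 ∧
      exp ((((((F.natDegree + 1 : ℕ) : ℝ) * a)⁻¹ : ℝ) : ℂ) * W + -(b / a)) =
        A.eval ((((((F.natDegree + 1 : ℕ) : ℝ) * a)⁻¹ : ℝ) : ℂ) * W + -(b / a)) +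
          exp (W / ((F.natDegree + 1 : ℕ) : ℂ)) * F.eval (exp (W / ((F.natDegree + 1 : ℕ) : ℂ))) := by
  classical
  -- names
  set e : ℕ := F.natDegree + 1 with he
  have he0 : (e : ℝ) ≠ 0 := by positivity
  have hepos : (0 : ℝ) < e := by positivity
  have ha : 0 < a := by
    by_contra h
    have : a * (F.natDegree + 1) ≤ 0 := mul_nonpos_of_nonpos_of_nonneg (not_lt.1 h) (by positivity)
    linarith
  set κ : ℝ := ((e : ℝ) * a)⁻¹ with hκ
  have hκpos : 0 < κ := by rw [hκ]; positivity
  set c : ℂ := F.leadingCoeff with hcdef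
  have hc0 : c ≠ 0 := Polynomial.leadingCoeff_ne_zero.2 hF
  set Ah : Polynomial ℂ := fastPoly a b A F with hAh
  have hA0 : A ≠ 0 := by rintro rfl; simp at hA
  have hAh0 : Ah ≠ 0 := by
    intro h
    have := natDegree_fastPoly ha.ne' b A hF
    rw [← hAh, h, Polynomial.natDegree_zero] at this
    omega
  have hdegAh : Ah.natDegree = A.natDegree := natDegree_fastPoly ha.ne' b A hF
  set d : ℕ := A.natDegree with hd
  set Fe : Polynomial ℂ := F.eraseLead with hFe
  -- data for the relative moving-polydisc theorem (`s = 1`)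
  set q : Fin 1 → ℤ := fun _ => 1 with hq
  set A' : Fin 1 → MvPolynomial (Fin 1) ℂ := fun _ => Ah.toMvPolynomial 0 with hA'def
  have hpi : (2 * Real.pi * I * ((1 : ℤ) : ℂ)) ≠ 0 := by
    have := Real.pi_pos
    simp [Complex.ext_iff, this.ne']
  have hA' : ∀ j, eval (fun i => 2 * Real.pi * I * (q i : ℂ))
      (homogeneousComponent (A' j).totalDegree (A' j)) ≠ 0 := fun _ =>
    eval_leadingForm_toMvPolynomial_fin_one_ne_zero hAh0 hpi
  set P : (Fin 1 → ℂ) → ℂ := fun W =>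
    c⁻¹ * (exp ((κ : ℂ) * W 0 + -(b / a)) - exp (W 0 / (e : ℂ)) * Fe.eval (exp (W 0 / (e : ℂ))))
    with hP
  have hPdiff : Differentiable ℂ P := by
    have h0 : Differentiable ℂ (fun W : Fin 1 → ℂ => W 0) := differentiable_apply 0
    refine (Differentiable.sub ?_ ?_).const_mul _
    · exact ((h0.const_mul _).add_const _).cexp
    · have h1 : Differentiable ℂ (fun W : Fin 1 → ℂ => exp (W 0 / (e : ℂ))) := by
        simp_rw [div_eq_mul_inv]
        exact (h0.mul_const _).cexp
      exact h1.mul (Fe.differentiable.comp h1)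
  -- the centre and the upper bound for `Re W` on the unit polydisc
  obtain ⟨C, t₀, ht₀, hctrl⟩ := latticeCentre_control_radius hAh0 one_ne_zero 1
  have hC0 : 0 ≤ C := by
    obtain ⟨m, hm⟩ := exists_nat_ge t₀
    have h := (hctrl m hm _ (by rw [sub_self, norm_zero]; exact zero_le_one)).1
    exact (abs_nonneg _).trans h
  -- ### relative smallness
  set B : ℝ := ∑ i ∈ Finset.range (Fe.natDegree + 1), ‖Fe.coeff i‖ with hB
  have hB0 : 0 ≤ B := Finset.sum_nonneg fun _ _ => norm_nonneg _
  set K₁ : ℝ := ‖c⁻¹‖ * Real.exp (κ * C + ‖b / a‖) with hK₁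
  set K₂ : ℝ := ‖c⁻¹‖ * (B * Real.exp C ^ (1 + Fe.natDegree)) with hK₂
  set μ₁ : ℝ := κ * d with hμ₁
  set μ₂ : ℝ := ((d : ℝ) / e) * (1 + Fe.natDegree) with hμ₂
  have hμ₁lt : μ₁ < d := by
    have hd0 : (0 : ℝ) < d := by exact_mod_cast hA
    have hκ1 : κ < 1 := by
      rw [hκ]
      refine inv_lt_one_of_one_lt₀ ?_
      have : (e : ℝ) = F.natDegree + 1 := by rw [he]; push_cast; ring
      rw [this]; linarith
    calc μ₁ = κ * d := rfl
      _ < 1 * d := mul_lt_mul_of_pos_right hκ1 hd0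
      _ = d := one_mul _
  have hPbound : ∀ᶠ k : ℕ in atTop, ∀ ξ : Fin 1 → ℂ, ‖ξ‖ < 1 →
      ‖P ((fun i => (k : ℂ) * (2 * Real.pi * I * (q i : ℂ)) +
          log (eval (fun l => (k : ℂ) * (2 * Real.pi * I * (q l : ℂ))) (A' i))) + ξ)‖ ≤
        K₁ * (k : ℝ) ^ μ₁ + (if Fe = 0 then 0 else K₂ * (k : ℝ) ^ μ₂) := by
    filter_upwards [tendsto_natCast_atTop_atTop.eventually_ge_atTop t₀] with k hk ξ hξ
    have hk1 : (1 : ℝ) ≤ k := ht₀.trans hk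
    have hk0 : (0 : ℝ) < k := by linarith
    set W : ℂ := ((k : ℂ) * (2 * Real.pi * I * ((1 : ℤ) : ℂ)) +
      log (Ah.eval ((k : ℂ) * (2 * Real.pi * I * ((1 : ℤ) : ℂ))))) + ξ 0 with hW
    have hWre : W.re ≤ d * Real.log k + C := by
      have h := (hctrl k hk W (by
        rw [hW, add_sub_cancel_left]
        exact ((norm_le_pi_norm ξ 0).trans hξ.le))).1
      rw [hdegAh] at h
      have := (abs_le.1 h).2
      linarith
    have hcoord : ((fun i => (k : ℂ) * (2 * Real.pi * I * (q i : ℂ)) +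
        log (eval (fun l => (k : ℂ) * (2 * Real.pi * I * (q l : ℂ))) (A' i))) + ξ) 0 = W := by
      simp only [Pi.add_apply, hA'def, hq, MvPolynomial.eval_toMvPolynomial, hW]
    -- first term
    have h1 : ‖exp ((κ : ℂ) * W + -(b / a))‖ ≤ Real.exp (κ * C + ‖b / a‖) * (k : ℝ) ^ μ₁ := by
      rw [Complex.norm_exp, Complex.add_re, Complex.re_ofReal_mul, Complex.neg_re]
      have hb : -(b / ↑a).re ≤ ‖b / a‖ := by
        have := Complex.abs_re_le_norm (b / a)
        rw [abs_le] at this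
        linarith [this.1]
      calc Real.exp (κ * W.re + -(b / ↑a).re)
          ≤ Real.exp (κ * (d * Real.log k + C) + ‖b / a‖) :=
            Real.exp_le_exp.2 (by nlinarith [mul_le_mul_of_nonneg_left hWre hκpos.le])
        _ = Real.exp (κ * C + ‖b / a‖) * (k : ℝ) ^ μ₁ := by
            rw [show κ * (d * Real.log k + C) + ‖b / a‖ = (κ * C + ‖b / a‖) + (κ * d) * Real.log k
              by ring, Real.exp_add, Real.rpow_def_of_pos hk0, hμ₁, mul_comm (Real.log k)]
    -- second term
    have hu : ‖exp (W / (e : ℂ))‖ ≤ Real.exp C * (k : ℝ) ^ ((d : ℝ) / e) := by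
      rw [Complex.norm_exp]
      have hre : (W / (e : ℂ)).re = W.re / e := by
        rw [show (e : ℂ) = ((e : ℝ) : ℂ) by push_cast; rfl, Complex.div_ofReal_re]
      rw [hre]
      calc Real.exp (W.re / e) ≤ Real.exp ((d * Real.log k + C) / e) :=
            Real.exp_le_exp.2 (div_le_div_of_nonneg_right hWre hepos.le)
        _ ≤ Real.exp (C + (d / e) * Real.log k) := by
            refine Real.exp_le_exp.2 ?_
            rw [add_div]
            have : C / e ≤ C := div_le_self hC0 (by
              have : (1 : ℝ) ≤ e := by rw [he]; exact_mod_cast Nat.succ_le_succ (Nat.zero_le _)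
              exact this)
            have : d * Real.log k / e = d / e * Real.log k := by ring
            linarith
        _ = Real.exp C * (k : ℝ) ^ ((d : ℝ) / e) := by
            rw [Real.exp_add, Real.rpow_def_of_pos hk0, mul_comm (Real.log k)]
    have hu1 : 1 ≤ Real.exp C * (k : ℝ) ^ ((d : ℝ) / e) := by
      have ha1 : (1 : ℝ) ≤ Real.exp C := Real.one_le_exp hC0
      have hb1 : (1 : ℝ) ≤ (k : ℝ) ^ ((d : ℝ) / e) := Real.one_le_rpow hk1 (by positivity)
      nlinarith
    have h2 : ‖exp (W / (e : ℂ)) * Fe.eval (exp (W / (e : ℂ)))‖ ≤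
        if Fe = 0 then 0 else B * Real.exp C ^ (1 + Fe.natDegree) * (k : ℝ) ^ μ₂ := by
      split_ifs with hFe0
      · rw [hFe0, Polynomial.eval_zero, mul_zero, norm_zero]
      · rw [norm_mul]
        have hmax : max 1 ‖exp (W / (e : ℂ))‖ ≤ Real.exp C * (k : ℝ) ^ ((d : ℝ) / e) :=
          max_le hu1 hu
        have hFe := (norm_eval_le_sum_mul_pow Fe (exp (W / (e : ℂ)))).trans
          (mul_le_mul_of_nonneg_left (pow_le_pow_left₀ (zero_le_one.trans (le_max_left _ _)) hmax _)
            hB0)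
        calc ‖exp (W / (e : ℂ))‖ * ‖Fe.eval (exp (W / (e : ℂ)))‖
            ≤ (Real.exp C * (k : ℝ) ^ ((d : ℝ) / e)) *
                (B * (Real.exp C * (k : ℝ) ^ ((d : ℝ) / e)) ^ Fe.natDegree) :=
              mul_le_mul hu hFe (norm_nonneg _) (by positivity)
          _ = B * (Real.exp C * (k : ℝ) ^ ((d : ℝ) / e)) ^ (1 + Fe.natDegree) := by ring
          _ = B * Real.exp C ^ (1 + Fe.natDegree) * (k : ℝ) ^ μ₂ := by
              rw [mul_pow, ← Real.rpow_natCast ((k : ℝ) ^ ((d : ℝ) / e)), ← Real.rpow_mul hk0.le, hμ₂]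
              push_cast
              ring
    -- combine
    rw [hP]
    simp only [hcoord]
    rw [norm_mul]
    calc ‖c⁻¹‖ * ‖exp ((κ : ℂ) * W + -(b / a)) - exp (W / (e : ℂ)) * Fe.eval (exp (W / (e : ℂ)))‖
        ≤ ‖c⁻¹‖ * (‖exp ((κ : ℂ) * W + -(b / a))‖ + ‖exp (W / (e : ℂ)) * Fe.eval (exp (W / (e : ℂ)))‖) :=
          mul_le_mul_of_nonneg_left (norm_sub_le _ _) (norm_nonneg _)
      _ ≤ ‖c⁻¹‖ * (Real.exp (κ * C + ‖b / a‖) * (k : ℝ) ^ μ₁ +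
            (if Fe = 0 then 0 else B * Real.exp C ^ (1 + Fe.natDegree) * (k : ℝ) ^ μ₂)) := by
          gcongr
      _ = K₁ * (k : ℝ) ^ μ₁ + (if Fe = 0 then 0 else K₂ * (k : ℝ) ^ μ₂) := by
          rw [hK₁, hK₂]
          split_ifs <;> ring
  have hPsmall : ∀ θ : ℝ, 0 < θ → ∀ᶠ k : ℕ in atTop, ∀ ξ : Fin 1 → ℂ, ‖ξ‖ < 1 →
      ‖P ((fun i => (k : ℂ) * (2 * Real.pi * I * (q i : ℂ)) +
          log (eval (fun l => (k : ℂ) * (2 * Real.pi * I * (q l : ℂ))) (A' i))) + ξ)‖ ≤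
        θ * (k : ℝ) ^ (A' 0).totalDegree := by
    intro θ hθ
    have hdeg' : (A' 0).totalDegree = d := by
      rw [hA'def]; exact (totalDegree_toMvPolynomial_fin_one Ah).trans hdegAh
    rw [hdeg']
    -- second exponent is `< d` when `Fe ≠ 0`
    have hsecond : ∀ᶠ k : ℕ in atTop,
        (if Fe = 0 then 0 else K₂ * (k : ℝ) ^ μ₂) ≤ θ / 2 * (k : ℝ) ^ (d : ℝ) := by
      by_cases hFe0 : Fe = 0
      · simp only [hFe0, if_true]
        filter_upwards [eventually_ge_atTop 1] with k hk
        positivity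
      · simp only [hFe0, if_false]
        have hμ₂lt : μ₂ < d := by
          have hf1 : 1 ≤ F.natDegree := by
            by_contra h
            push Not at h
            have h0 : F.natDegree = 0 := by omega
            apply hFe0
            rw [hFe, Polynomial.eq_C_of_natDegree_eq_zero h0, Polynomial.eraseLead_C]
          have hFedeg : Fe.natDegree ≤ F.natDegree - 1 := Polynomial.eraseLead_natDegree_le F
          have hlt : (1 + Fe.natDegree : ℝ) < e := by
            rw [he]
            have : 1 + Fe.natDegree < F.natDegree + 1 := by omega
            exact_mod_cast this
          have hd0 : (0 : ℝ) < d := by exact_mod_cast hA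
          rw [hμ₂]
          calc (d : ℝ) / e * (1 + Fe.natDegree) < (d : ℝ) / e * e :=
                mul_lt_mul_of_pos_left hlt (by positivity)
            _ = d := by field_simp
        exact eventually_const_mul_rpow_le K₂ hμ₂lt (half_pos hθ)
    filter_upwards [hPbound, eventually_const_mul_rpow_le K₁ hμ₁lt (half_pos hθ), hsecond]
      with k hk hk1 hk2 ξ hξ
    have h := hk ξ hξ
    rw [← Real.rpow_natCast]
    linarith
  -- ### the relative moving-polydisc theorem
  have hsol := exists_exp_eq_poly_add_near_latticeCentre_local q A' hA' (fun _ _ => P)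
    (Eventually.of_forall fun k j => hPdiff.differentiableOn) (fun j θ hθ => by
      have hj : j = 0 := Subsingleton.elim _ _
      subst hj
      exact hPsmall θ hθ)
  filter_upwards [hsol] with k ⟨Wv, hWv, hsys⟩
  set W : ℂ := Wv 0 with hWdef
  refine ⟨W, ?_, ?_⟩
  · refine (norm_le_pi_norm (Wv - _) 0).trans_eq' ?_ |>.trans hWv
    simp only [Pi.sub_apply, hA'def, hq, MvPolynomial.eval_toMvPolynomial, hWdef]
  · have h := hsys 0
    simp only [hA'def, MvPolynomial.eval_toMvPolynomial, hP] at h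
    -- `h : exp W = Ah.eval W + c⁻¹ * (exp z - u F̃(u))`
    have hAh_eval : Ah.eval W = -c⁻¹ * A.eval ((κ : ℂ) * W + -(b / a)) := by
      rw [hAh, fastPoly, Polynomial.eval_mul, Polynomial.eval_C, Polynomial.eval_comp, eval_linePoly]
    set u : ℂ := exp (W / (e : ℂ)) with hu
    have hue : u ^ e = exp W := by
      rw [hu, ← Complex.exp_nat_mul, mul_div_cancel₀ _ (by exact_mod_cast (show e ≠ 0 by positivity))]
    have hsplit := mul_eval_eq_leadingCoeff_mul_pow_add F u
    rw [← he, hue, ← hcdef] at hsplit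
    -- from `h`
    have h' : c * exp W = -A.eval ((κ : ℂ) * W + -(b / a)) +
        (exp ((κ : ℂ) * W + -(b / a)) - u * Fe.eval u) := by
      rw [← hWdef] at h
      rw [h, hAh_eval]
      field_simp
    show exp ((κ : ℂ) * W + -(b / a)) = A.eval ((κ : ℂ) * W + -(b / a)) + u * F.eval u
    rw [hsplit]
    rw [hFe] at h'
    linear_combination -h'

end Fast

end Summit.Schanuel.Schanuel.Theorems

end
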